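import Mathlib
import Summits.KontsevichZagierPeriods.KontsevichZagierPeriods.Theses.TerasomaMultiplication

/-!
# Sketch — crux-ideate stmt-KontsevichZagierPeriods-12305 (MultiplicationAccessible), ideator 3, round 1

First lemmas of the three idea cards (statements only; they must ELABORATE, they are not proved here):

* `IdeaSketch3.FourierVieta*`   — card `fourier-vieta-transposition`
* `IdeaSketch3.CharacterOrthogonalityMove` (+ context `TorsionFree` [landed], `AlgebraicScalarCancel`,
  `ScalingEndomorphism` [= tree `KZ.scale`]) — card `idempotent-rank-one-transposition`
* `IdeaSketch3.ConifoldOnlyCriticalValue`, `IdeaSketch3.BoxSliceConfinement`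
                                 — card `pham-join-conifold-localisation`
-/

noncomputable section

open scoped BigOperators
open Complex

namespace Summit.KontsevichZagierPeriods.KontsevichZagierPeriods.Cruxes.MultiplicationAccessible.IdeaSketch3

open Literature.NumberTheory.Transcendental

/-- the crux, by name (sanity: the route decl is in scope). -/
example : Prop := Summit.KontsevichZagierPeriods.KontsevichZagierPeriods.Theses.TerasomaMultiplication.MultiplicationAccessible

/-- Primitive `n`-th root of unity used by the Fourier–Vieta map. -/
def ζ (n : ℕ) : ℂ := Complex.exp (2 * Real.pi * Complex.I / n)

/-- Terasoma's covering, s-free and d-free: `σ j y = ∏ i, (1 - ζ^j · y i) = P_y(ζ^j)` with `P_y(T) = ∏ (1 - y_i T)`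
(values of the Vieta polynomial at the `n`-th roots of unity = DFT of its coefficient vector). -/
def σ (n : ℕ) (y : Fin (n - 1) → ℂ) (j : Fin n) : ℂ := ∏ i, (1 - (ζ n) ^ (j : ℕ) * y i)

/-- Card 1, first lemma (a): the image lies on the simplex hyperplane and the product is the common weight:
`Σ_j σ_j = n` and `∏_j σ_j = ∏_i (1 - y_i ^ n)` for every `y ∈ ℂ^{n-1}`, `n ≥ 2`. -/
def FourierVietaSumProd : Prop :=
  ∀ (n : ℕ), 2 ≤ n → ∀ y : Fin (n - 1) → ℂ,
    (∑ j : Fin n, σ n y j) = n ∧ (∏ j : Fin n, σ n y j) = ∏ i, (1 - y i ^ n)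

/-- Card 1, first lemma (b): the Jacobian of `y ↦ (σ_1, …, σ_{n-1})` (drop `σ_0`; on the hyperplane `Σσ = n` the form
`dσ_1 ∧ … ∧ dσ_{n-1}` is the simplex volume form) is `c_n · Vandermonde(y)` with `c_n^4 = n^{2(n-2)}`
(numerically `c_2 = 1, c_3 = i√3, c_4 = -4i, c_5 = -5√5, c_6 = -36, c_7 = -7^{5/2} i`; `c_3 = i√3` is O–Y's constant). -/
def FourierVietaJacobian : Prop :=
  ∀ (n : ℕ), 2 ≤ n → ∃ c : ℂ, c ^ 4 = (n : ℂ) ^ (2 * (n - 2)) ∧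
    ∀ y : Fin (n - 1) → ℂ,
      (Matrix.of fun (j : Fin (n - 1)) (i : Fin (n - 1)) =>
          -((ζ n) ^ ((j : ℕ) + 1)) * ∏ k ∈ Finset.univ.erase i, (1 - (ζ n) ^ ((j : ℕ) + 1) * y k)).det
        = c * ∏ i : Fin (n - 1), ∏ k ∈ Finset.Ioi i, (y i - y k)

/-- Card 1, first lemma (c) (twisted boxes see the determinant character): for `a : Fin (n-1) → ℕ` the alternating sum
over permutations of the characters of the monomials `y^{π δ}`, `δ = (0,1,…,n-2)`, on the twisted box `ζ^a · (0,1)^{n-1}`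
is the generalised Vandermonde `det (ζ^{a_j (k+1)})`. Pure algebra; it is what makes `∫_{ζ^a·box} V · w^{s-1} dy =
det(ζ^{a_j (k+1)}) · box_s / n^{n-1}`. -/
def TwistedBoxCharacter : Prop :=
  ∀ (n : ℕ), 2 ≤ n → ∀ a : Fin (n - 1) → ℕ,
    (∑ π : Equiv.Perm (Fin (n - 1)), ((Equiv.Perm.sign π : ℤ) : ℂ) * ∏ k, (ζ n) ^ (a k * ((π k : ℕ) + 1)))
      = (Matrix.of fun (j : Fin (n - 1)) (k : Fin (n - 1)) => (ζ n) ^ (a j * ((k : ℕ) + 1))).det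

/-- Card 2, first lemma: the CHARACTER-ORTHOGONALITY MOVE (the atomic step of the idempotent transposition).
A `ℚ`-semialgebraic linear automorphism `Φ` of `ℝ^N` of finite order `n` with `|det Φ| = 1` (e.g. a coordinate
rotation `y_i ↦ ζ^{a_i} y_i` of `ℂ^m = ℝ^{2m}`), a pair of real integrands `(f, g)` = (Re, Im) of a `χ_c`-eigenfunction
(`(f + i g) ∘ Φ = ζ^c (f + i g)`), `n ∤ c`: then the `n` representations `[Φ^k D, f]` SUM TO A RELATION
(`n` changes of variables + `n - 1` integrand additivities + the zero representation; values: `Σ_k ζ^{ck} = 0`).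
With torsion-freeness (LANDED: `Negative/Core.mem_relations_of_nsmul_mem_relations`) and algebraic scalar
cancellation (`KZ.scale`), this makes the group-ring idempotents `|G|·e_χ ∈ ℤ[ζ][G]` usable INSIDE the calculus. -/
def CharacterOrthogonalityMove : Prop :=
  ∀ (N n c : ℕ), 0 < n → ¬ n ∣ c →
  ∀ (Φ : (Fin N → ℝ) →ₗ[ℝ] (Fin N → ℝ)), IsSemialgebraicMapOn ℚ Set.univ Φ →
    |LinearMap.det Φ| = 1 → Φ ^ n = 1 →
  ∀ (D : Set (Fin N → ℝ)) (f g : (Fin N → ℝ) → ℝ),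
    (∀ x, f (Φ x) = Real.cos (2 * Real.pi * c / n) * f x - Real.sin (2 * Real.pi * c / n) * g x) →
    (∀ x, g (Φ x) = Real.sin (2 * Real.pi * c / n) * f x + Real.cos (2 * Real.pi * c / n) * g x) →
  ∀ (r : Fin n → KZ.IntegralRep N),
    (∀ k, (r k).domain = (⇑(Φ ^ (k : ℕ))) '' D ∧ Set.EqOn (r k).integrand f (r k).domain) →
    ∑ k, KZ.of (r k) ∈ KZ.relations

/-- Card 2, context (ALREADY LANDED for this crux as `Summit.KontsevichZagierPeriods.MultiplicationAccessible.Negative.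
mem_relations_of_nsmul_mem_relations`, Theorems/MultiplicationAccessible/Negative/Core.lean §3; restated here only to fix
notation): the KZ period group `FormalRep ⧸ relations` is TORSION-FREE.
Proof idea (3 lines on paper): `[r] - N • [r/N] ∈ relations` by `N-1` integrand-additivity moves, and the scaling map
`r ↦ r/N` sends each of the four move sets into itself. -/
def TorsionFree : Prop :=
  ∀ (N : ℕ) (c : KZ.FormalRep), N ≠ 0 → N • c ∈ KZ.relations → c ∈ KZ.relations

/-- Card 2, first lemma (b): ALGEBRAIC SCALAR CANCELLATION (two-term form, scaled representations pinned by hypotheses,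
as in the route's `BetaCancellation`): if `a` is a non-zero real algebraic number and `[a·r] ~ [a·r']` then `[r] ~ [r']`.
(Transcendental scalars — `π`, Beta values — are exactly what does NOT cancel for free: PiCancellation/BetaCancellation.) -/
def AlgebraicScalarCancel : Prop :=
  ∀ (a : ℝ), IsAlgebraic ℚ a → a ≠ 0 →
    ∀ ⦃n m : ℕ⦄ (r q : KZ.IntegralRep n) (r' q' : KZ.IntegralRep m),
      q.domain = r.domain → Set.EqOn q.integrand (fun x => a * r.integrand x) q.domain →
      q'.domain = r'.domain → Set.EqOn q'.integrand (fun x => a * r'.integrand x) q'.domain →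
      KZ.Equivalent q q' → KZ.Equivalent r r'

/-- Card 2, the lever itself: for every non-zero real algebraic `a` there is an additive endomorphism of `FormalRep`
realising `[r] ↦ [a·r]` on generators and mapping `relations` into `relations`. -/
def ScalingEndomorphism : Prop :=
  ∀ (a : ℝ), IsAlgebraic ℚ a → a ≠ 0 →
    ∃ φ : KZ.FormalRep →+ KZ.FormalRep,
      (∀ ⦃n : ℕ⦄ (r q : KZ.IntegralRep n), q.domain = r.domain →
          Set.EqOn q.integrand (fun x => a * r.integrand x) q.domain → φ (KZ.of r) - KZ.of q ∈ KZ.relations) ∧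
      ∀ c ∈ KZ.relations, φ c ∈ KZ.relations

/-- Card 3, first lemma (a): over `w ≠ 0` the weight `w(y) = ∏ (1 - y_i^n)` on `ℂ^{n-1}` has `y = 0` as its ONLY
critical point (critical value `w = 1`, the conifold point): if no factor vanishes and all partials
`∂w/∂y_i = -n y_i^{n-1} ∏_{k≠i}(1 - y_k^n)` vanish then `y = 0`. This is what licenses transporting a homology
relation along the real interval `w ∈ (0,1)` (Ehresmann/Hardt) and proving it inside a Milnor ball at `y = 0`. -/
def ConifoldOnlyCriticalValue : Prop :=
  ∀ (n : ℕ), 2 ≤ n → ∀ y : Fin (n - 1) → ℂ,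
    (∀ k, 1 - y k ^ n ≠ 0) →
    (∀ i, (n : ℂ) * y i ^ (n - 1) * ∏ k ∈ Finset.univ.erase i, (1 - y k ^ n) = 0) → y = 0

/-- Card 3, first lemma (b): Milnor-ball confinement of the box slices: on `{t ∈ [0,1]^{n-1} : ∏ (1 - t_i^n) ≥ 1 - ε}`
every coordinate satisfies `t_i^n ≤ ε` (so for `w → 1` the Pham cells `ζ^a ·` slice shrink into any ball). -/
def BoxSliceConfinement : Prop :=
  ∀ (n : ℕ), 2 ≤ n → ∀ (ε : ℝ), 0 ≤ ε → ∀ t : Fin (n - 1) → ℝ,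
    (∀ i, t i ∈ Set.Icc (0:ℝ) 1) → 1 - ε ≤ ∏ i, (1 - t i ^ n) → ∀ i, t i ^ n ≤ ε

end Summit.KontsevichZagierPeriods.KontsevichZagierPeriods.Cruxes.MultiplicationAccessible.IdeaSketch3
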